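/-
PART G of the rh-li THEORY dossier (cell rh-li, seat rh-li-theory g7, 2026-08-26T04:02Z).
Custody: rh-li-theory.  Filing: `ledger propose --kind definition --target
Summits/RiemannHypothesis/RiemannHypothesis/Theorems/LiEchoSieveDefs.lean` AFTER PART E
(`Theorems/LiEchoDirichletDefs.lean`) has landed — this file imports it.
Checked form: HOME/theory/route/p5/SketchG.lean (= PART E body + this section; farm rc 0, 0 sorries).
Rev 04:41Z: `conj (χ a) = χ a⁻¹` is CITED from `Literature.NumberTheory.Sieve.LargeSieve.conj_apply_of_isUnit`
(gate dedup.landed), not restated.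
-/
import Summits.RiemannHypothesis.RiemannHypothesis.Theorems.LiEchoDirichletDefs
import Literature.NumberTheory.Sieve.LargeSieveCharacters

/-!
# The Dirichlet ECHO SIEVE — class-resolved prime echoes (T-G of HOME/theory/TARGETS.md §13.5 (v))

LABELS: **RH-FREE, GRH-FREE** (a statement about finite window sums over zeros of `ζ` and of the `L(s, χ)`,
`χ mod q`, whatever their real parts) · **PROOF-OF-DATA** · **COROLLARY** (PROVED here: `liEchoSieve_of`) of the
ζ echo law `LiZeroWindowEcho` (PART D, leaf of route LiPrimeEcho) and the complex Dirichlet echo law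
`LiZeroWindowEchoDirichletComplex` (PART E, companion of the leaf of route LiDirichletEcho).  Not a route and not a
crux: it closes when those two close.  Typed because its DATA FACE is the clean control experiment of the echo
mechanism: averaging the per-character window discrepancies `D_χ(n) = W_χ(n; √n, c√n) − S_χ(n; √n, c√n)` with the
weights `χ(b)` over all characters mod a prime `q ≥ 3` isolates, by orthogonality (Mathlib
`DirichletCharacter.sum_char_inv_mul_char_eq`), the residue class of the resonating prime 2:

  `(1/φ(q)) Σ_χ χ(b) D_χ(n) = −[b ≡ 2 (mod q)] · E₂(n) + O_{q,c}(log² n)`,  `E₂(n) = liPrimeEcho 2 n ≍ n^{1/4}`.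

So mod 5 the chirp lives in class 2 and classes 1, 3, 4 are silent; mod 3 in class 2; mod 7 in class 2 — a
prediction eng can test from the L-function zero lists (LMFDB / lcalc) with the ζ list as the trivial-character term.
WHAT THIS IS NOT: anything about the real parts of zeros; nothing here bears on the truth of RH or GRH.
-/

noncomputable section

-- D-0017: `Summit.<S>.<S>.…` is the designed namespace of a single-problem summit.
set_option linter.dupNamespace false

open scoped ComplexConjugate

namespace Summit.RiemannHypothesis.RiemannHypothesis.Theorems.LiTheory

variable {q : ℕ} [NeZero q]

/-! ### The DIRICHLET ECHO SIEVE: class-resolved echoes mod a prime `q`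

Averaging the per-character complex law with the weights `χ(b)` over ALL characters mod a prime `q ≥ 3` isolates,
by orthogonality, the residue class of the resonating prime: the class statistic
`(1/φ(q)) Σ_χ χ(b)·[W_χ(n) − S_χ(n)]` (for the trivial character: ζ's real window discrepancy `Z − S` of PART D,
conductor 1) carries the chirp `−E₂(n)` EXACTLY in the class `b ≡ 2 (mod q)` and is `O(log² n)` in every other class.
A COROLLARY (PROVED below: `liEchoSieve_of`) of `LiZeroWindowEcho` (ζ) and `LiZeroWindowEchoDirichletComplex`;
typed as a PROOF-OF-DATA target because its data face is a clean control experiment (q = 3: classes 1 and 2;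
q = 5: the echo sits in class 2 only, classes 1, 3, 4 silent; q = 7: class 2).  RH-FREE, GRH-FREE. -/

/-- Per-character complex window discrepancy `D_χ(n; T₁, T₂) = W_χ − S_χ`; for the trivial character (any modulus)
the conductor-1 objects of PART D: `D_1 = Z_ζ − S_ζ` (real). -/
def charEchoDiscrepancy (χ : DirichletCharacter ℂ q) (n : ℕ) (T₁ T₂ : ℝ) : ℂ :=
  if χ = 1 then ((liZeroTraceWindow n T₁ T₂ - liSmoothTraceWindow n T₁ T₂ : ℝ) : ℂ)
  else charZeroTraceWindowC χ n T₁ T₂ - (charSmoothTraceWindow χ n T₁ T₂ : ℂ)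

/-- The CLASS STATISTIC `(1/φ(q)) Σ_{χ mod q} χ(b) · D_χ(n; √n, c√n)`. -/
def liEchoClassStat (q : ℕ) [NeZero q] (b : ZMod q) (c : ℝ) (n : ℕ) : ℂ :=
  ((q.totient : ℂ))⁻¹ *
    ∑ χ : DirichletCharacter ℂ q, χ b * charEchoDiscrepancy χ n (Real.sqrt n) (c * Real.sqrt n)

/-- **T-G `LiEchoSieve` — the DIRICHLET ECHO SIEVE (RH-FREE, GRH-FREE; PROOF-OF-DATA; corollary of the ζ echo law
and the complex Dirichlet echo law, `liEchoSieve_of`).**  For a prime `q ≥ 3`, a unit `b mod q` and `c ≥ 5/4` there is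
`C` with, for all `n ≥ 2`,

  `‖ (1/φ(q)) Σ_χ χ(b) D_χ(n; √n, c√n) + [b = 2]·E₂(n) ‖ ≤ C log² n`.

KILL (data): a prime q and a class b ≢ 2 whose class statistic shows the n^{1/4} chirp, or the class of 2 without it. -/
@[conjecture] def LiEchoSieve : Prop :=
  ∀ (q : ℕ) [NeZero q], q.Prime → 2 < q → ∀ b : ZMod q, IsUnit b → ∀ c : ℝ, 5 / 4 ≤ c →
    ∃ C : ℝ, ∀ n : ℕ, 2 ≤ n →
      ‖liEchoClassStat q b c n + (if b = 2 then (liPrimeEcho 2 n : ℂ) else 0)‖ ≤ C * Real.log n ^ 2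

/-- Non-trivial characters of prime level are primitive. [folklore] -/
theorem isPrimitive_of_prime_of_ne_one {p : ℕ} [NeZero p] (hp : p.Prime) (χ : DirichletCharacter ℂ p)
    (hχ : χ ≠ 1) : χ.IsPrimitive := by
  rw [DirichletCharacter.isPrimitive_def]
  have hd : DirichletCharacter.conductor χ ∣ p := DirichletCharacter.conductor_dvd_level χ
  rcases (Nat.dvd_prime hp).1 hd with h | h
  · exact absurd ((DirichletCharacter.eq_one_iff_conductor_eq_one (χ := χ)).mpr h) hχ
  · exact h

/-- **PROVED REDUCTION**: the ζ echo law and the complex Dirichlet echo law imply the echo sieve. -/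
theorem liEchoSieve_of (hζ : LiZeroWindowEcho) (hχ : LiZeroWindowEchoDirichletComplex) : LiEchoSieve := by
  intro q _ hp hq2 b hb c hc
  classical
  have hq1 : 1 < q := hp.one_lt
  -- per-character constants
  have per : ∀ χ : DirichletCharacter ℂ q, ∃ C : ℝ, ∀ n : ℕ, 2 ≤ n →
      ‖charEchoDiscrepancy χ n (Real.sqrt n) (c * Real.sqrt n) + conj (χ (2 : ZMod q)) * (liPrimeEcho 2 n : ℂ)‖
        ≤ C * Real.log n ^ 2 := by
    intro χ
    by_cases h1 : χ = 1
    · subst h1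
      obtain ⟨C, hC⟩ := hζ c hc
      refine ⟨C, fun n hn ↦ ?_⟩
      have h2u : IsUnit (2 : ZMod q) := by
        have : (2 : ZMod q) = ((2 : ℕ) : ZMod q) := by norm_cast
        rw [this, ZMod.isUnit_iff_coprime]
        exact (Nat.coprime_primes Nat.prime_two hp).2 (by omega)
      have hone : (1 : DirichletCharacter ℂ q) (2 : ZMod q) = 1 := MulChar.one_apply h2u
      simp only [charEchoDiscrepancy, if_true, hone, map_one, one_mul]
      have := hC n hn
      rw [← Complex.ofReal_add, Complex.norm_real]
      simpa using this
    · obtain ⟨C, hC⟩ := hχ q χ (isPrimitive_of_prime_of_ne_one hp χ h1) hq1 c hc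
      refine ⟨C, fun n hn ↦ ?_⟩
      simpa [charEchoDiscrepancy, h1] using hC n hn
  choose Cχ hCχ using per
  refine ⟨((q.totient : ℝ))⁻¹ * ∑ χ : DirichletCharacter ℂ q, |Cχ χ|, fun n hn ↦ ?_⟩
  -- orthogonality: Σ_χ χ(b) conj(χ 2) = Σ_χ χ(2⁻¹) χ(b) = [2 = b] φ(q)
  have h2u : IsUnit (2 : ZMod q) := by
    have : (2 : ZMod q) = ((2 : ℕ) : ZMod q) := by norm_cast
    rw [this, ZMod.isUnit_iff_coprime]
    exact (Nat.coprime_primes Nat.prime_two hp).2 (by omega)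
  have horth : ∑ χ : DirichletCharacter ℂ q, χ b * conj (χ (2 : ZMod q)) =
      if b = 2 then (q.totient : ℂ) else 0 := by
    have h := DirichletCharacter.sum_char_inv_mul_char_eq ℂ h2u b
    have : ∀ χ : DirichletCharacter ℂ q, χ b * conj (χ (2 : ZMod q)) = χ (2 : ZMod q)⁻¹ * χ b := by
      intro χ; rw [Literature.NumberTheory.Sieve.LargeSieve.conj_apply_of_isUnit χ h2u, mul_comm]
    simp_rw [this, h]
    by_cases hb2 : b = 2
    · subst hb2; simp
    · have : ¬ (2 : ZMod q) = b := fun h ↦ hb2 h.symm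
      simp [hb2, this]
  have hφ : (q.totient : ℂ) ≠ 0 := by
    exact_mod_cast (Nat.totient_pos.mpr (by omega)).ne'
  have hφpos : (0 : ℝ) < q.totient := by exact_mod_cast Nat.totient_pos.mpr (by omega)
  -- rewrite the statistic + indicator as the average of the per-character corrected terms
  have key : liEchoClassStat q b c n + (if b = 2 then (liPrimeEcho 2 n : ℂ) else 0) =
      ((q.totient : ℂ))⁻¹ * ∑ χ : DirichletCharacter ℂ q,
        χ b * (charEchoDiscrepancy χ n (Real.sqrt n) (c * Real.sqrt n)
          + conj (χ (2 : ZMod q)) * (liPrimeEcho 2 n : ℂ)) := by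
    have hind : (if b = 2 then (liPrimeEcho 2 n : ℂ) else 0) =
        ((q.totient : ℂ))⁻¹ * ((∑ χ : DirichletCharacter ℂ q, χ b * conj (χ (2 : ZMod q))) *
          (liPrimeEcho 2 n : ℂ)) := by
      rw [horth]
      split_ifs with hb2
      · field_simp
      · simp
    rw [hind, liEchoClassStat, ← mul_add, Finset.sum_mul, ← Finset.sum_add_distrib]
    congr 1
    refine Finset.sum_congr rfl fun χ _ ↦ ?_
    ring
  have hlog : (0 : ℝ) ≤ Real.log n ^ 2 := sq_nonneg _
  have hterm : ∀ χ : DirichletCharacter ℂ q,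
      ‖χ b * (charEchoDiscrepancy χ n (Real.sqrt n) (c * Real.sqrt n)
          + conj (χ (2 : ZMod q)) * (liPrimeEcho 2 n : ℂ))‖ ≤ |Cχ χ| * Real.log n ^ 2 := by
    intro χ
    rw [norm_mul]
    have hχb : ‖χ b‖ ≤ 1 := χ.norm_le_one b
    have h1 := hCχ χ n hn
    have hC' : Cχ χ * Real.log n ^ 2 ≤ |Cχ χ| * Real.log n ^ 2 :=
      mul_le_mul_of_nonneg_right (le_abs_self _) hlog
    calc ‖χ b‖ * ‖charEchoDiscrepancy χ n (Real.sqrt n) (c * Real.sqrt n)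
            + conj (χ (2 : ZMod q)) * (liPrimeEcho 2 n : ℂ)‖
        ≤ 1 * (|Cχ χ| * Real.log n ^ 2) := by
          gcongr
          exact h1.trans hC'
      _ = |Cχ χ| * Real.log n ^ 2 := one_mul _
  rw [key]
  calc ‖((q.totient : ℂ))⁻¹ * ∑ χ : DirichletCharacter ℂ q,
          χ b * (charEchoDiscrepancy χ n (Real.sqrt n) (c * Real.sqrt n)
            + conj (χ (2 : ZMod q)) * (liPrimeEcho 2 n : ℂ))‖
      = ((q.totient : ℝ))⁻¹ * ‖∑ χ : DirichletCharacter ℂ q,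
          χ b * (charEchoDiscrepancy χ n (Real.sqrt n) (c * Real.sqrt n)
            + conj (χ (2 : ZMod q)) * (liPrimeEcho 2 n : ℂ))‖ := by
        rw [norm_mul, norm_inv, Complex.norm_natCast]
    _ ≤ ((q.totient : ℝ))⁻¹ * ∑ χ : DirichletCharacter ℂ q, |Cχ χ| * Real.log n ^ 2 := by
        gcongr
        exact (norm_sum_le _ _).trans (Finset.sum_le_sum fun χ _ ↦ hterm χ)
    _ = ((q.totient : ℝ))⁻¹ * (∑ χ : DirichletCharacter ℂ q, |Cχ χ|) * Real.log n ^ 2 := by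
        rw [← Finset.sum_mul]; ring

end Summit.RiemannHypothesis.RiemannHypothesis.Theorems.LiTheory

end
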